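import Summits.AtomisticToContinuum.BoseEinsteinCondensation.Theorems.BECPhaseQuadratureSumRuleSumRuleChainGlueWindow
import Summits.AtomisticToContinuum.BoseEinsteinCondensation.Theorems.BECPhaseQuadratureSumRuleSumRuleChainGlueCurrent
import Summits.AtomisticToContinuum.BoseEinsteinCondensation.Theorems.BECPhaseQuadratureSumRuleSumRuleChainGlueEnergy
import HarnessLib

/-!
# Route `BECPhaseQuadratureSumRule`, glue `SumRuleChainGlue` (stmt-AtomisticToContinuum-12627) —
# helper: the mode sum `Σ_{p≠0} ‖a_p a_0Ψ‖²` of a torus minimiser from the engine and the three cruxes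

For a periodic trial state `Ψ` of `N = n+2` bosons on the torus of side `L` (in the glue: the minimiser of
`-ΣΔ + tΣv^per`) this file turns the INSTANCES at `Ψ` of the route's statements into the bound on
`Σ_{p≠0} T_p`, `T_p = ‖a_p a_0Ψ‖²`, that drives the dichotomy:

* `ir_current_le` — from the engine inequality `m₂² ≤ 4m₁M₃` of `CurrentSumRule` at a mode `p ≠ 0`, the energy
  budget `⟨Ψ,H_tΨ⟩ ≤ E_b` and a close-pair budget `E_Ψ[#close pairs] ≤ E_cl`:
  `m₂/‖k‖⁴ ≤ 2N(1 + √δ'/‖k‖)` with `δ' = (12E_b + 2(R₀²Cₑ(η/2)E_cl + R₀²Cₑ/(2η) E_b))/N` (files `…Current`);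
* `tsum_pairOcc_ne_zero_le` — `Σ_{p≠0} T_p ≤ (N-1)K₀⁻²E_b + ε_R N² + (64/25)ε_L N² + Σ_window 2N(1 + √δ'/‖k_p‖)`:
  ultraviolet tail (file `…Window`), and on the infrared window `T_p ≤ (m₂ + R_A)/‖k‖⁴ + ‖ρ†Ψ‖² + R_ρ`
  (file `…PerMode`) with the remainders summed by `NonCondensateRemainders` (`ε_R`), the densities by
  `LongWaveStructureBound` (`ε_L`, file `…Window`) and the currents by `ir_current_le`;
* `sum_window_current_le` — `Σ_window 2N(1 + √δ'/‖k_p‖) ≤ 2N(192M³ + 96√δ'(L/2π)M²)`, `M = LK₀/2π` (file `…Lattice`).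
-/

noncomputable section

open MeasureTheory Filter Set
open scoped ENNReal NNReal Topology BigOperators

namespace Summit.AtomisticToContinuum.BoseEinsteinCondensation.Theorems.SumRuleChainGlue

open Literature.MathematicalPhysics.QuantumManyBody.BoseGas

variable {n : ℕ} {L : ℝ}

/-! ### The infrared current from the engine -/

/-- **The infrared current bound from the engine.** At a mode `p ≠ 0`, the engine inequality of `CurrentSumRule`
together with the directional kinetic bound, the Puff potential bound (edge condition, `η`-split), the energy
budget `E_b` and the close-pair budget `E_cl` give `m₂/‖k‖⁴ ≤ 2N(1 + √δ'/‖k‖)`. -/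
theorem ir_current_le {v : ℝ → ℝ≥0∞} {R₀ Cₑ t η Eb Ecl : ℝ} (hmeas : Measurable v)
    (hR : ∀ r, R₀ < r → v r = 0) (h2R : 2 * R₀ < L) (hL : 0 < L) (hfin : ∀ r, v r ≠ ⊤)
    (hC2 : ContDiff ℝ 2 fun x : Space => (v ‖x‖).toReal) (hCₑ : 0 ≤ Cₑ)
    (hedge : ∀ x : Space, ‖iteratedFDeriv ℝ 2 (fun x : Space => (v ‖x‖).toReal) x‖ ≤ Cₑ * Real.sqrt ((v ‖x‖).toReal))
    (ht : 0 ≤ t) (ht1 : t ≤ 1) (hη : 0 < η) (hEb : 0 ≤ Eb) (hEcl : 0 ≤ Ecl)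
    (Ψ : PeriodicTrialState (n + 2) L)
    (hE : periodicEnergy (fun r => ENNReal.ofReal t * v r) Ψ ≤ ENNReal.ofReal Eb)
    (hclose : ∫⁻ X in cellN (n + 2) L, periodicInteraction ((Set.Iic R₀).indicator fun _ => (1 : ℝ≥0∞)) L X *
      (‖Ψ.ψ X‖₊ : ℝ≥0∞) ^ 2 ≤ ENNReal.ofReal Ecl)
    {p : Fin 3 → ℤ} (hp : p ≠ 0)
    (hS : (∫⁻ X in cellN (n + 2) L, (‖currentAmp L p Ψ.ψ X‖₊ : ℝ≥0∞) ^ 2) ^ 2 ≤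
      4 * (ENNReal.ofReal (((n + 2 : ℕ) : ℝ) * ‖kvec L p‖ ^ 2) * (ENNReal.ofReal (12 * ‖kvec L p‖ ^ 2) *
        (∑ j : Fin (n + 2), ∫⁻ X in cellN (n + 2) L, (‖fderiv ℝ Ψ.ψ X (Pi.single j (kvec L p))‖₊ : ℝ≥0∞) ^ 2) +
        ENNReal.ofReal (((n + 2 : ℕ) : ℝ) * ‖kvec L p‖ ^ 6) +
        4 * ∫⁻ X in cellN (n + 2) L, (∑ i : Fin (n + 2), ∑ j : Fin (n + 2) with i < j, ENNReal.ofReal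
          ((1 - Real.cos (inner ℝ (kvec L p) (X i - X j))) *
            |fderiv ℝ (fun z : Space => fderiv ℝ (fun z : Space => ∑' m : Fin 3 → ℤ, t * (v ‖z - latticeVec L m‖).toReal) z
              (kvec L p)) (X i - X j) (kvec L p)|)) * (‖Ψ.ψ X‖₊ : ℝ≥0∞) ^ 2))) :
    (∫⁻ X in cellN (n + 2) L, (‖currentAmp L p Ψ.ψ X‖₊ : ℝ≥0∞) ^ 2) / ENNReal.ofReal (‖kvec L p‖ ^ 4) ≤
      ENNReal.ofReal (2 * ((n + 2 : ℕ) : ℝ) * (1 + Real.sqrt ((12 * Eb + 2 * (R₀ ^ 2 * Cₑ * η / 2 * Ecl +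
        R₀ ^ 2 * Cₑ / (2 * η) * Eb)) / ((n + 2 : ℕ) : ℝ)) / ‖kvec L p‖)) := by
  set k : Space := kvec L p with hk
  set N : ℝ := ((n + 2 : ℕ) : ℝ) with hN
  have hNpos : 0 < N := by rw [hN]; positivity
  have hkpos : 0 < ‖k‖ := norm_kvec_pos hL hp
  set Q : ℝ := R₀ ^ 2 * Cₑ * η / 2 * Ecl + R₀ ^ 2 * Cₑ / (2 * η) * Eb with hQ
  have hQ0 : 0 ≤ Q := by rw [hQ]; positivity
  set δ' : ℝ := (12 * Eb + 2 * Q) / N with hδ'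
  have hδ'0 : 0 ≤ δ' := by rw [hδ']; positivity
  -- energies
  have hKE : ∫⁻ X in cellN (n + 2) L, kineticDensity Ψ.ψ X ≤ ENNReal.ofReal Eb :=
    (lintegral_kineticDensity_le_periodicEnergy _ Ψ).trans hE
  have hPE : ∫⁻ X in cellN (n + 2) L, periodicInteraction (fun r => ENNReal.ofReal t * v r) L X *
      (‖Ψ.ψ X‖₊ : ℝ≥0∞) ^ 2 ≤ ENNReal.ofReal Eb :=
    (lintegral_periodicInteraction_le_periodicEnergy _ Ψ).trans hE
  -- the directional kinetic term
  have hD : ENNReal.ofReal (12 * ‖k‖ ^ 2) *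
      (∑ j : Fin (n + 2), ∫⁻ X in cellN (n + 2) L, (‖fderiv ℝ Ψ.ψ X (Pi.single j k)‖₊ : ℝ≥0∞) ^ 2) ≤
      ENNReal.ofReal (12 * ‖k‖ ^ 4 * Eb) := by
    calc _ ≤ ENNReal.ofReal (12 * ‖k‖ ^ 2) * (ENNReal.ofReal (‖k‖ ^ 2) * ∫⁻ X in cellN (n + 2) L, kineticDensity Ψ.ψ X) :=
          mul_le_mul_of_nonneg_left (sum_lintegral_fderiv_single_le Ψ k) bot_le
      _ ≤ ENNReal.ofReal (12 * ‖k‖ ^ 2) * (ENNReal.ofReal (‖k‖ ^ 2) * ENNReal.ofReal Eb) := by gcongr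
      _ = ENNReal.ofReal (12 * ‖k‖ ^ 4 * Eb) := by
          rw [← ENNReal.ofReal_mul (by positivity), ← ENNReal.ofReal_mul (by positivity)]; congr 1; ring
  -- the potential term
  have hPot : 4 * ∫⁻ X in cellN (n + 2) L, (∑ i : Fin (n + 2), ∑ j : Fin (n + 2) with i < j, ENNReal.ofReal
      ((1 - Real.cos (inner ℝ k (X i - X j))) *
        |fderiv ℝ (fun z : Space => fderiv ℝ (fun z : Space => ∑' m : Fin 3 → ℤ, t * (v ‖z - latticeVec L m‖).toReal) z k)
          (X i - X j) k|)) * (‖Ψ.ψ X‖₊ : ℝ≥0∞) ^ 2 ≤ ENNReal.ofReal (2 * ‖k‖ ^ 4 * Q) := by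
    have h := puffPotential_le (N := n + 2) hmeas hR h2R hL hfin hC2 hCₑ hedge ht ht1 hη p Ψ
    rw [show ((2 * Real.pi / L) • latticeVec 1 p : Space) = k from rfl] at h
    calc _ ≤ 4 * (ENNReal.ofReal (‖k‖ ^ 4 / 2) * (ENNReal.ofReal (R₀ ^ 2 * Cₑ * η / 2) * ENNReal.ofReal Ecl +
          ENNReal.ofReal (R₀ ^ 2 * Cₑ / (2 * η)) * ENNReal.ofReal Eb)) := by
          refine mul_le_mul_of_nonneg_left (h.trans ?_) bot_le
          gcongr
      _ = ENNReal.ofReal (2 * ‖k‖ ^ 4 * Q) := by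
          rw [← ENNReal.ofReal_mul (by positivity), ← ENNReal.ofReal_mul (by positivity),
            ← ENNReal.ofReal_add (by positivity) (by positivity), ← ENNReal.ofReal_mul (by positivity),
            show (4 : ℝ≥0∞) = ENNReal.ofReal 4 by norm_num, ← ENNReal.ofReal_mul (by norm_num)]
          congr 1; rw [hQ]; ring
  -- the bracket `M₃/(N‖k‖²)`
  have hbr : ENNReal.ofReal (12 * ‖k‖ ^ 2) *
        (∑ j : Fin (n + 2), ∫⁻ X in cellN (n + 2) L, (‖fderiv ℝ Ψ.ψ X (Pi.single j k)‖₊ : ℝ≥0∞) ^ 2) +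
        ENNReal.ofReal (N * ‖k‖ ^ 6) +
        4 * ∫⁻ X in cellN (n + 2) L, (∑ i : Fin (n + 2), ∑ j : Fin (n + 2) with i < j, ENNReal.ofReal
          ((1 - Real.cos (inner ℝ k (X i - X j))) *
            |fderiv ℝ (fun z : Space => fderiv ℝ (fun z : Space => ∑' m : Fin 3 → ℤ, t * (v ‖z - latticeVec L m‖).toReal) z k)
              (X i - X j) k|)) * (‖Ψ.ψ X‖₊ : ℝ≥0∞) ^ 2 ≤
      ENNReal.ofReal (N * ‖k‖ ^ 4 * (‖k‖ ^ 2 + δ')) := by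
    calc _ ≤ ENNReal.ofReal (12 * ‖k‖ ^ 4 * Eb) + ENNReal.ofReal (N * ‖k‖ ^ 6) + ENNReal.ofReal (2 * ‖k‖ ^ 4 * Q) :=
          add_le_add (add_le_add hD le_rfl) hPot
      _ = ENNReal.ofReal (N * ‖k‖ ^ 4 * (‖k‖ ^ 2 + δ')) := by
          rw [← ENNReal.ofReal_add (by positivity) (by positivity), ← ENNReal.ofReal_add (by positivity) (by positivity)]
          congr 1
          rw [hδ']
          field_simp
          ring
  -- the engine
  have hsq : (∫⁻ X in cellN (n + 2) L, (‖currentAmp L p Ψ.ψ X‖₊ : ℝ≥0∞) ^ 2) ^ 2 ≤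
      ENNReal.ofReal (4 * N ^ 2 * ‖k‖ ^ 6 * (‖k‖ ^ 2 + δ')) := by
    refine hS.trans ?_
    calc 4 * (ENNReal.ofReal (N * ‖k‖ ^ 2) * _) ≤ 4 * (ENNReal.ofReal (N * ‖k‖ ^ 2) * ENNReal.ofReal (N * ‖k‖ ^ 4 * (‖k‖ ^ 2 + δ'))) :=
          mul_le_mul_of_nonneg_left (mul_le_mul_of_nonneg_left hbr bot_le) bot_le
      _ = ENNReal.ofReal (4 * N ^ 2 * ‖k‖ ^ 6 * (‖k‖ ^ 2 + δ')) := by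
          rw [← ENNReal.ofReal_mul (by positivity), show (4 : ℝ≥0∞) = ENNReal.ofReal 4 by norm_num,
            ← ENNReal.ofReal_mul (by norm_num)]
          congr 1; ring
  have hres := current_div_le hNpos.le hkpos hδ'0 hsq
  simpa only [hδ', hQ] using hres

/-! ### The mode sum -/

/-- The decomposition `1[p ≠ 0] = 1_{window}(p) + 1_{tail}(p)` of the mode sum. -/
theorem ite_eq_indicator_add_indicator (hL : 0 < L) {K₀ : ℝ} (hK₀ : 0 < K₀) (f : (Fin 3 → ℤ) → ℝ≥0∞) (p : Fin 3 → ℤ) :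
    (if p = 0 then 0 else f p) = {p : Fin 3 → ℤ | p ≠ 0 ∧ ‖kvec L p‖ < K₀}.indicator f p +
      {p : Fin 3 → ℤ | K₀ ≤ ‖kvec L p‖}.indicator f p := by
  by_cases hp : p = 0
  · subst hp
    have h0 : ‖kvec L (0 : Fin 3 → ℤ)‖ = 0 := by simp [kvec]
    rw [if_pos rfl, Set.indicator_of_notMem (fun h => h.1 rfl),
      Set.indicator_of_notMem (fun h : (0 : Fin 3 → ℤ) ∈ {p : Fin 3 → ℤ | K₀ ≤ ‖kvec L p‖} => by
        have h' : K₀ ≤ ‖kvec L (0 : Fin 3 → ℤ)‖ := h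
        rw [h0] at h'; exact absurd h' (not_le.2 hK₀)), add_zero]
  · have _ := hL
    rw [if_neg hp]
    by_cases hlt : ‖kvec L p‖ < K₀
    · rw [Set.indicator_of_mem (show p ∈ {p : Fin 3 → ℤ | p ≠ 0 ∧ ‖kvec L p‖ < K₀} from ⟨hp, hlt⟩),
        Set.indicator_of_notMem (fun h : p ∈ {p : Fin 3 → ℤ | K₀ ≤ ‖kvec L p‖} => by
          have h' : K₀ ≤ ‖kvec L p‖ := h
          exact absurd hlt (not_lt.2 h')), add_zero]
    · rw [Set.indicator_of_notMem (fun h : p ∈ {p : Fin 3 → ℤ | p ≠ 0 ∧ ‖kvec L p‖ < K₀} => hlt h.2),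
        Set.indicator_of_mem (show p ∈ {p : Fin 3 → ℤ | K₀ ≤ ‖kvec L p‖} from not_lt.1 hlt), zero_add]

/-- **The mode sum of a torus state from the engine and the three cruxes** (instances at `Ψ`):
`Σ_{p≠0} T_p ≤ (N-1)K₀⁻²E_b + ε_R N² + (64/25)ε_L N² + Σ_window 2N(1 + √δ'/‖k_p‖)`. -/
theorem tsum_pairOcc_ne_zero_le {v : ℝ → ℝ≥0∞} {R₀ Cₑ t η Eb Ecl K₀ ρ εR εL : ℝ} (hmeas : Measurable v)
    (hR : ∀ r, R₀ < r → v r = 0) (h2R : 2 * R₀ < L) (hL : 0 < L) (hfin : ∀ r, v r ≠ ⊤)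
    (hC2 : ContDiff ℝ 2 fun x : Space => (v ‖x‖).toReal) (hCₑ : 0 ≤ Cₑ)
    (hedge : ∀ x : Space, ‖iteratedFDeriv ℝ 2 (fun x : Space => (v ‖x‖).toReal) x‖ ≤ Cₑ * Real.sqrt ((v ‖x‖).toReal))
    (ht : 0 ≤ t) (ht1 : t ≤ 1) (hη : 0 < η) (hEb : 0 ≤ Eb) (hEcl : 0 ≤ Ecl) (hK₀ : 0 < K₀) (hℓL : K₀⁻¹ < L)
    (hεL : 0 ≤ εL) (hN : ρ * L ^ 3 = (n + 2 : ℕ))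
    (Ψ : PeriodicTrialState (n + 2) L)
    (hE : periodicEnergy (fun r => ENNReal.ofReal t * v r) Ψ ≤ ENNReal.ofReal Eb)
    (hclose : ∫⁻ X in cellN (n + 2) L, periodicInteraction ((Set.Iic R₀).indicator fun _ => (1 : ℝ≥0∞)) L X *
      (‖Ψ.ψ X‖₊ : ℝ≥0∞) ^ 2 ≤ ENNReal.ofReal Ecl)
    (hS : ∀ p : Fin 3 → ℤ, p ≠ 0 → (∫⁻ X in cellN (n + 2) L, (‖currentAmp L p Ψ.ψ X‖₊ : ℝ≥0∞) ^ 2) ^ 2 ≤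
      4 * (ENNReal.ofReal (((n + 2 : ℕ) : ℝ) * ‖kvec L p‖ ^ 2) * (ENNReal.ofReal (12 * ‖kvec L p‖ ^ 2) *
        (∑ j : Fin (n + 2), ∫⁻ X in cellN (n + 2) L, (‖fderiv ℝ Ψ.ψ X (Pi.single j (kvec L p))‖₊ : ℝ≥0∞) ^ 2) +
        ENNReal.ofReal (((n + 2 : ℕ) : ℝ) * ‖kvec L p‖ ^ 6) +
        4 * ∫⁻ X in cellN (n + 2) L, (∑ i : Fin (n + 2), ∑ j : Fin (n + 2) with i < j, ENNReal.ofReal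
          ((1 - Real.cos (inner ℝ (kvec L p) (X i - X j))) *
            |fderiv ℝ (fun z : Space => fderiv ℝ (fun z : Space => ∑' m : Fin 3 → ℤ, t * (v ‖z - latticeVec L m‖).toReal) z
              (kvec L p)) (X i - X j) (kvec L p)|)) * (‖Ψ.ψ X‖₊ : ℝ≥0∞) ^ 2)))
    (hRem : ∑' p : Fin 3 → ℤ, {p : Fin 3 → ℤ | p ≠ 0 ∧ ‖kvec L p‖ < K₀}.indicator (fun p =>
      (∫⁻ X in cellN (n + 2) L, (‖currentAmpNc L p Ψ.ψ X‖₊ : ℝ≥0∞) ^ 2) / ENNReal.ofReal (‖kvec L p‖ ^ 4) +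
        ∫⁻ X in cellN (n + 2) L, (‖densityAmpNc L p Ψ.ψ X‖₊ : ℝ≥0∞) ^ 2) p ≤ ENNReal.ofReal (εR * ((n + 2 : ℕ) : ℝ) ^ 2))
    (hLW : ∫⁻ u in cell L, ∫⁻ X in cellN (n + 2) L, (∑ j : Fin (n + 2), ∑' m : Fin 3 → ℤ,
        (slidingBox K₀⁻¹ u).indicator (fun _ => (1 : ℝ≥0∞)) (X j + latticeVec L m)) ^ 2 * (‖Ψ.ψ X‖₊ : ℝ≥0∞) ^ 2 ≤
      ENNReal.ofReal ((1 + εL) * (ρ * K₀⁻¹ ^ 3) ^ 2 * L ^ 3)) :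
    ∑' p : Fin 3 → ℤ, (if p = 0 then 0 else pairOcc L p Ψ.ψ) ≤
      ((n + 1 : ℕ) : ℝ≥0∞) * ENNReal.ofReal ((K₀ ^ 2)⁻¹) * ENNReal.ofReal Eb + ENNReal.ofReal (εR * ((n + 2 : ℕ) : ℝ) ^ 2) +
        ENNReal.ofReal (64 / 25 * εL * ((n + 2 : ℕ) : ℝ) ^ 2) +
        ∑ p ∈ (Fintype.piFinset fun _ : Fin 3 => Finset.Icc (-(⌈L * K₀ / (2 * Real.pi)⌉₊ : ℤ)) ⌈L * K₀ / (2 * Real.pi)⌉₊).filter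
          (fun p => p ≠ 0 ∧ ‖(2 * Real.pi / L) • latticeVec 1 p‖ < K₀),
          ENNReal.ofReal (2 * ((n + 2 : ℕ) : ℝ) * (1 + Real.sqrt ((12 * Eb + 2 * (R₀ ^ 2 * Cₑ * η / 2 * Ecl +
            R₀ ^ 2 * Cₑ / (2 * η) * Eb)) / ((n + 2 : ℕ) : ℝ)) / ‖kvec L p‖)) := by
  set W := (Fintype.piFinset fun _ : Fin 3 => Finset.Icc (-(⌈L * K₀ / (2 * Real.pi)⌉₊ : ℤ)) ⌈L * K₀ / (2 * Real.pi)⌉₊).filter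
    (fun p => p ≠ 0 ∧ ‖(2 * Real.pi / L) • latticeVec 1 p‖ < K₀) with hW
  -- split into window and tail
  have hsplit : ∑' p : Fin 3 → ℤ, (if p = 0 then 0 else pairOcc L p Ψ.ψ) =
      ∑' p : Fin 3 → ℤ, {p : Fin 3 → ℤ | p ≠ 0 ∧ ‖kvec L p‖ < K₀}.indicator (fun p => pairOcc L p Ψ.ψ) p +
        ∑' p : Fin 3 → ℤ, {p : Fin 3 → ℤ | K₀ ≤ ‖kvec L p‖}.indicator (fun p => pairOcc L p Ψ.ψ) p := by
    rw [← ENNReal.tsum_add]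
    exact tsum_congr fun p => ite_eq_indicator_add_indicator hL hK₀ (fun p => pairOcc L p Ψ.ψ) p
  -- the tail
  have htail : ∑' p : Fin 3 → ℤ, {p : Fin 3 → ℤ | K₀ ≤ ‖kvec L p‖}.indicator (fun p => pairOcc L p Ψ.ψ) p ≤
      ((n + 1 : ℕ) : ℝ≥0∞) * ENNReal.ofReal ((K₀ ^ 2)⁻¹) * ENNReal.ofReal Eb :=
    (uv_tail_le hL Ψ hK₀).trans (mul_le_mul_of_nonneg_left ((lintegral_kineticDensity_le_periodicEnergy _ Ψ).trans hE) bot_le)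
  -- the window, mode by mode
  have hwin : ∑' p : Fin 3 → ℤ, {p : Fin 3 → ℤ | p ≠ 0 ∧ ‖kvec L p‖ < K₀}.indicator (fun p => pairOcc L p Ψ.ψ) p ≤
      ∑ p ∈ W, ((∫⁻ X in cellN (n + 2) L, (‖currentAmp L p Ψ.ψ X‖₊ : ℝ≥0∞) ^ 2) / ENNReal.ofReal (‖kvec L p‖ ^ 4) +
        ((∫⁻ X in cellN (n + 2) L, (‖currentAmpNc L p Ψ.ψ X‖₊ : ℝ≥0∞) ^ 2) / ENNReal.ofReal (‖kvec L p‖ ^ 4) +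
          ∫⁻ X in cellN (n + 2) L, (‖densityAmpNc L p Ψ.ψ X‖₊ : ℝ≥0∞) ^ 2) +
        ∫⁻ X in cellN (n + 2) L, (‖densityAmp L p Ψ.ψ X‖₊ : ℝ≥0∞) ^ 2) := by
    rw [tsum_indicator_irWindow_eq_sum hL K₀]
    refine Finset.sum_le_sum fun p hp => ?_
    rw [Finset.mem_filter] at hp
    refine (pairOcc_le_split hL Ψ hp.2.1).trans (le_of_eq ?_)
    rw [ENNReal.add_div]
    ring
  rw [hsplit]
  refine (add_le_add hwin htail).trans ?_
  rw [Finset.sum_add_distrib, Finset.sum_add_distrib, ← tsum_indicator_irWindow_eq_sum hL K₀ (fun p =>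
    (∫⁻ X in cellN (n + 2) L, (‖currentAmpNc L p Ψ.ψ X‖₊ : ℝ≥0∞) ^ 2) / ENNReal.ofReal (‖kvec L p‖ ^ 4) +
      ∫⁻ X in cellN (n + 2) L, (‖densityAmpNc L p Ψ.ψ X‖₊ : ℝ≥0∞) ^ 2)]
  have hcur : ∑ p ∈ W, (∫⁻ X in cellN (n + 2) L, (‖currentAmp L p Ψ.ψ X‖₊ : ℝ≥0∞) ^ 2) / ENNReal.ofReal (‖kvec L p‖ ^ 4) ≤
      ∑ p ∈ W, ENNReal.ofReal (2 * ((n + 2 : ℕ) : ℝ) * (1 + Real.sqrt ((12 * Eb + 2 * (R₀ ^ 2 * Cₑ * η / 2 * Ecl +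
        R₀ ^ 2 * Cₑ / (2 * η) * Eb)) / ((n + 2 : ℕ) : ℝ)) / ‖kvec L p‖)) := by
    refine Finset.sum_le_sum fun p hp => ?_
    rw [hW, Finset.mem_filter] at hp
    exact ir_current_le hmeas hR h2R hL hfin hC2 hCₑ hedge ht ht1 hη hEb hEcl Ψ hE hclose hp.2.1 (hS p hp.2.1)
  have hden := ir_density_le hL Ψ hK₀ hℓL hεL hN hLW
  calc _ ≤ (∑ p ∈ W, ENNReal.ofReal (2 * ((n + 2 : ℕ) : ℝ) * (1 + Real.sqrt ((12 * Eb + 2 * (R₀ ^ 2 * Cₑ * η / 2 * Ecl +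
        R₀ ^ 2 * Cₑ / (2 * η) * Eb)) / ((n + 2 : ℕ) : ℝ)) / ‖kvec L p‖)) + ENNReal.ofReal (εR * ((n + 2 : ℕ) : ℝ) ^ 2) +
        ENNReal.ofReal (64 / 25 * εL * ((n + 2 : ℕ) : ℝ) ^ 2)) +
        ((n + 1 : ℕ) : ℝ≥0∞) * ENNReal.ofReal ((K₀ ^ 2)⁻¹) * ENNReal.ofReal Eb :=
        add_le_add (add_le_add (add_le_add hcur hRem) hden) le_rfl
    _ = _ := by ring

/-- **The window sum of the current bounds by lattice counting** (`d = 3`): with `M = LK₀/2π ≥ 1`,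
`Σ_window 2N(1 + √δ'/‖k_p‖) ≤ 2N(192 M³ + 96 √δ' (L/2π) M²)`. -/
theorem sum_window_current_le (hL : 0 < L) {K₀ N δ' : ℝ} (hK₀ : 0 ≤ K₀) (hN : 0 ≤ N)
    (hM : 1 ≤ L * K₀ / (2 * Real.pi)) :
    ∑ p ∈ (Fintype.piFinset fun _ : Fin 3 => Finset.Icc (-(⌈L * K₀ / (2 * Real.pi)⌉₊ : ℤ)) ⌈L * K₀ / (2 * Real.pi)⌉₊).filter
        (fun p => p ≠ 0 ∧ ‖(2 * Real.pi / L) • latticeVec 1 p‖ < K₀),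
        ENNReal.ofReal (2 * N * (1 + Real.sqrt δ' / ‖kvec L p‖)) ≤
      ENNReal.ofReal (2 * N * (192 * (L * K₀ / (2 * Real.pi)) ^ 3 +
        96 * Real.sqrt δ' * (L / (2 * Real.pi)) * (L * K₀ / (2 * Real.pi)) ^ 2)) := by
  set W := (Fintype.piFinset fun _ : Fin 3 => Finset.Icc (-(⌈L * K₀ / (2 * Real.pi)⌉₊ : ℤ)) ⌈L * K₀ / (2 * Real.pi)⌉₊).filter
    (fun p => p ≠ 0 ∧ ‖(2 * Real.pi / L) • latticeVec 1 p‖ < K₀) with hW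
  rw [← ENNReal.ofReal_sum_of_nonneg fun p _ => by positivity]
  refine ENNReal.ofReal_le_ofReal ?_
  have hcard := card_irWindow_le hL hM
  have hsum := sum_inv_norm_kvec_le hL hK₀
  rw [← hW] at hcard hsum
  have h1 : ∑ p ∈ W, 2 * N * (1 + Real.sqrt δ' / ‖kvec L p‖) =
      2 * N * ((W.card : ℝ) + Real.sqrt δ' * ∑ p ∈ W, ‖(2 * Real.pi / L) • latticeVec 1 p‖⁻¹) := by
    calc ∑ p ∈ W, 2 * N * (1 + Real.sqrt δ' / ‖kvec L p‖)
        = ∑ p ∈ W, (2 * N + 2 * N * Real.sqrt δ' * ‖(2 * Real.pi / L) • latticeVec 1 p‖⁻¹) :=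
          Finset.sum_congr rfl fun p _ => by simp only [kvec]; ring
      _ = 2 * N * (W.card : ℝ) + 2 * N * Real.sqrt δ' * ∑ p ∈ W, ‖(2 * Real.pi / L) • latticeVec 1 p‖⁻¹ := by
          rw [Finset.sum_add_distrib, Finset.sum_const, nsmul_eq_mul, ← Finset.mul_sum]; ring
      _ = _ := by ring
  rw [h1]
  refine mul_le_mul_of_nonneg_left ?_ (by positivity)
  have h2 : Real.sqrt δ' * ∑ p ∈ W, ‖(2 * Real.pi / L) • latticeVec 1 p‖⁻¹ ≤
      Real.sqrt δ' * (96 * (L / (2 * Real.pi)) * (L * K₀ / (2 * Real.pi)) ^ 2) :=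
    mul_le_mul_of_nonneg_left hsum (Real.sqrt_nonneg _)
  linarith

end Summit.AtomisticToContinuum.BoseEinsteinCondensation.Theorems.SumRuleChainGlue

end
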